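import Summits.AtomisticToContinuum.HydrodynamicLimit.Theses.RingDensityCertificate

/-!
# Birth skeleton for crux `RingDensityLaw` (stmt-AtomisticToContinuum-12126, route `RingDensityCertificate`, rank 2)

Crux (FIXED, imported and concluded BY NAME):
`Summit.AtomisticToContinuum.HydrodynamicLimit.Theses.RingDensityCertificate.RingDensityLaw` — along the
local-Gibbs-started hard-sphere flow at fixed reduced density `σ`, in every small cell `B(x₀,h)` and kinetic window
`[t, t + w_N]` (`w_N = M/(σ²ρ√θ(N+1)^{1/3})`, `M` local kinetic units) the ring-collision count `Z_ring` equals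
`r_E(N)·Z_coll` up to `δ·Z_coll` with probability `→ 1`, where `r_E(N) = E_Q[Z'_ring]/E_Q[Z'_coll]` is the ring
fraction of the HOMOGENEOUS equilibrium comparison system (density 1, temperature `θ_t(x₀)`, diameter
`σ' = σρ_t(x₀)^{1/3}`, window of the same `M` kinetic units, any comparison flow family `Ψ`).

## The cut (three registered stubs, composition PROVED)

* `stub_equilibriumRingLLN` (M) — EQUILIBRIUM LAW OF LARGE NUMBERS FOR THE RING RATIO of the comparison system:
  below an absolute packing threshold `η₁` (chosen first), for every diameter parameter `σ'` with `σ'³ < η₁`, every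
  temperature, window multiplier `M`, tolerance and comparison flow family, `Q'_N(|Z'_ring − r_E(N) Z'_coll| >
  δ' Z'_coll) → 0`: the centring constant of the crux is an honest LLN centre (whole torus = `σ'²(N+1)^{1/3} → ∞`
  mean free paths, window = `M` mean free times, spatial decorrelation of a microscopic-time functional under the
  low-activity Gibbs state; the in-probability shadow of the route's support `EquilibriumRingLD`, but at the
  rescaled diameter and with `M, δ'` AFTER `σ'`). Cheapest falsifier / first technical debt: a.e.-measurability and
  `Q`-integrability of `z ↦ Z'_coll, Z'_ring` (else the Bochner integrals in `r_E` are junk `0` and the stub — and the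
  crux — assert a vanishing ring fraction, which is false at fixed `σ'`).
* `stub_noRingExcess` (XL, the flow-side upper half) — NO RING EXCESS ALONG THE FLOW relative to the equilibrium
  value: with the crux's quantifier prefix verbatim, and GIVEN the equilibrium concentration of the comparison
  system at the matched state `(σρ_t(x₀)^{1/3}, θ_t(x₀))`, `P_N(Z_ring − r_E(N) Z_coll > δ Z_coll) → 0`. This is the
  half the certificate needs if the route pivots to the one-sided form (route KILL CRITERIA: "¬RingDensityLaw …
  forces a pivot to the one-sided certificate (ring EXCESS only)"); mechanism: excess recollisions are
  large-deviation-rare under local equilibrium (tilt/Cauchy–Schwarz transfer against the invariant law for small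
  data; zoom / super-extensive LD for large data).
* `stub_noRingDeficit` (XL, the flow-side lower half) — NO RING DEFICIT ALONG THE FLOW: same prefix and hypothesis,
  `P_N(r_E(N) Z_coll − Z_ring > δ Z_coll) → 0` (shear/dilation separating would-be recolliders is the physical
  enemy; same LD-transfer mechanism at small data).

Composition `RingDensityLaw_of` (PROVED, no `sorry`): `η₀ := min η₁ (min η₂ η₃)`, `σ₀ := min`, `h₀ := min`;
positivity of `ρ_t(x₀), θ_t(x₀)` from `IsHardSphereEulerSolution` (`t ∈ (0,T) ⊆ [0,T)`), the cube identity
`(σρ^{1/3})³ = ρσ³ < η₀ ≤ η₁` feeding the equilibrium stub at the matched state, then the union bound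
`{δZ_c < |Z_r − rZ_c|} ⊆ {δZ_c < Z_r − rZ_c} ∪ {δZ_c < rZ_c − Z_r}` and a squeeze in `ℝ≥0∞`. The crux's seven `let`s
are abbreviated by the `def`s of §Vocabulary (verbatim bodies, parametrised), and `namedLaw_iff : NamedLaw ↔
RingDensityLaw` holds by `Iff.rfl`.

Disproof.lean: none exists for this crux (crux dir empty at registration, 2026-08-17). Negatives index of the
summit: no refuted statement is restated (the stubs are one-sided / conditional weakenings of the vetted crux
plus a pure equilibrium LLN).
-/

noncomputable section

namespace Summit.AtomisticToContinuum.HydrodynamicLimit.Cruxes.RingDensityLaw.Birth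

open scoped BigOperators Topology Manifold Classical MeasureTheory ProbabilityTheory Matrix InnerProductSpace ComplexConjugate ContinuousMap
open Filter Set Function TopologicalSpace MeasureTheory
open Literature.MathematicalPhysics.KineticTheory Literature.Analysis.FluidPDE

/-! ### Vocabulary — the crux's `let`s as parametrised definitions (verbatim bodies; no new mathematics) -/

/-- The flow's kinetic window `w_N = M/(σ²·ρ·√θ·(N+1)^{1/3})` (the crux's `let w`, with `ρ = ρ_t(x₀)`,
`θ = θ_t(x₀)`). -/
def flowWindow (M σ ρv θv : ℝ) (N : ℕ) : ℝ :=
  M / (σ ^ 2 * (ρv * Real.sqrt θv * ((N + 1 : ℕ) : ℝ) ^ (1 / 3 : ℝ)))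

/-- The comparison system's window `w'_N = M/(σ'²·√θ·(N+1)^{1/3})` (the crux's `let w'`, with
`σ' = σρ_t(x₀)^{1/3}`). -/
def eqWindow (M σ' θv : ℝ) (N : ℕ) : ℝ :=
  M / (σ' ^ 2 * (Real.sqrt θv * ((N + 1 : ℕ) : ℝ) ^ (1 / 3 : ℝ)))

/-- Collision times of the ordered pair `(i, j)` in the window `[a, a + ℓ]` with `x_i` in the cell `B(x₀, r)`
(the crux's `let Tc`). -/
def collTimes (x₀ : T3) (N : ℕ) (ε : ℝ) (γ : ℝ → Config (N + 1) (Fin 3) (UnitAddTorus (Fin 3))) (a ℓ r : ℝ)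
    (i j : Fin (N + 1)) : Set ℝ :=
  {s : ℝ | s ∈ Set.Icc a (a + ℓ) ∧ γ s ∈ contactSet (Torus.geometry (Fin 3)) (N + 1) ε i j ∧ Torus.euclidDist (γ s i).1 x₀ < r}

/-- Backward cluster of particle `i` over the time window `[a, b)`: particles reached by a time-decreasing
collision chain (the crux's `let Bc`; AokiEtAl2015 §1). -/
def backCluster (N : ℕ) (ε : ℝ) (γ : ℝ → Config (N + 1) (Fin 3) (UnitAddTorus (Fin 3))) (a b : ℝ)
    (i : Fin (N + 1)) : Set (Fin (N + 1)) :=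
  {k : Fin (N + 1) | ∃ (m : ℕ) (p : Fin (m + 1) → Fin (N + 1)) (τ : Fin m → ℝ), p 0 = i ∧ p (Fin.last m) = k ∧ StrictAnti τ ∧ ∀ l : Fin m, τ l ∈ Set.Ico a b ∧ γ (τ l) ∈ contactSet (Torus.geometry (Fin 3)) (N + 1) ε (p l.castSucc) (p l.succ)}

/-- Ordered collision count in cell × window (the crux's `let Zc`). -/
def zColl (x₀ : T3) (N : ℕ) (ε : ℝ) (γ : ℝ → Config (N + 1) (Fin 3) (UnitAddTorus (Fin 3))) (a ℓ r : ℝ) : ℝ :=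
  ∑ i : Fin (N + 1), ∑ j : Fin (N + 1), if i ≠ j then ∑ᶠ s ∈ collTimes x₀ N ε γ a ℓ r i j, (1 : ℝ) else 0

/-- Ordered `M`-RING collision count in cell × window: collisions whose two backward clusters over the preceding
window of length `ℓ` intersect (the crux's `let Zr`). -/
def zRing (x₀ : T3) (N : ℕ) (ε : ℝ) (γ : ℝ → Config (N + 1) (Fin 3) (UnitAddTorus (Fin 3))) (a ℓ r : ℝ) : ℝ :=
  ∑ i : Fin (N + 1), ∑ j : Fin (N + 1), if i ≠ j then ∑ᶠ s ∈ collTimes x₀ N ε γ a ℓ r i j, Set.indicator {s' : ℝ | ∃ k, k ∈ backCluster N ε γ (s' - ℓ) s' i ∧ k ∈ backCluster N ε γ (s' - ℓ) s' j} 1 s else 0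

/-- The EQUILIBRIUM RING FRACTION `r_E(N) = E_Q[Z'_ring]/E_Q[Z'_coll]` of the homogeneous comparison system
(canonical law of activity `1`, velocity `0`, temperature `θv`, diameter parameter `σ'`; whole torus = cell radius
`2`; window `[0, w'_N]`) — the crux's `let rE`, with the comparison flow `Ψ N` as the last argument. -/
def rEq (x₀ : T3) (σ' θv M : ℝ) (N : ℕ)
    (Ψ : HardSphereFlow (Torus.geometry (Fin 3)) (hsDiameter σ' N) (N + 1)) : ℝ :=
  (∫ z, zRing x₀ N (hsDiameter σ' N) (fun s => Ψ.flow s z) 0 (eqWindow M σ' θv N) 2 ∂localGibbsLaw σ' 1 0 (fun _ => θv) N Ψ) /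
    (∫ z, zColl x₀ N (hsDiameter σ' N) (fun s => Ψ.flow s z) 0 (eqWindow M σ' θv N) 2 ∂localGibbsLaw σ' 1 0 (fun _ => θv) N Ψ)

/-- EQUILIBRIUM CONCENTRATION OF THE RING RATIO of the comparison system `(σ', θv, M, Ψ)`: for every tolerance
`δ' > 0`, `Q'_N(δ'·Z'_coll < |Z'_ring − r_E(N)·Z'_coll|) → 0` as `N → ∞` (the conclusion of the equilibrium stub and
the hypothesis of the two flow-side stubs). -/
def EqRingConcentration (x₀ : T3) (σ' θv M : ℝ)
    (Ψ : (N : ℕ) → HardSphereFlow (Torus.geometry (Fin 3)) (hsDiameter σ' N) (N + 1)) : Prop :=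
  ∀ δ' : ℝ, 0 < δ' →
    Filter.Tendsto (fun N : ℕ => localGibbsLaw σ' 1 0 (fun _ => θv) N (Ψ N)
      {z | δ' * zColl x₀ N (hsDiameter σ' N) (fun s => (Ψ N).flow s z) 0 (eqWindow M σ' θv N) 2 <
        |zRing x₀ N (hsDiameter σ' N) (fun s => (Ψ N).flow s z) 0 (eqWindow M σ' θv N) 2 -
          rEq x₀ σ' θv M N (Ψ N) * zColl x₀ N (hsDiameter σ' N) (fun s => (Ψ N).flow s z) 0 (eqWindow M σ' θv N) 2|})
      Filter.atTop (nhds 0)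

/-! ### The three statements of the skeleton (named `Prop`s) -/

/-- **E · EquilibriumRingLLN** (M). Below an absolute packing threshold `η₁`, the ring-count RATIO of the
homogeneous equilibrium hard-sphere gas over a window of `M` kinetic units concentrates around its ratio of
expectations `r_E(N)`: `∃ η₁ > 0, ∀ σ' > 0, σ'³ < η₁ → ∀ θv > 0, ∀ M > 0, ∀ x₀, ∀ Ψ, EqRingConcentration x₀ σ' θv M Ψ`.
Why plausibly true: `Z'_coll, Z'_ring` are sums over `N + 1` particles of functionals of the trajectory over `M`
mean free times, with dependency range `O(M)` mean free paths on a torus `σ'²(N+1)^{1/3} → ∞` mean free paths wide;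
variance `O(N)` against means `Θ(N)` (dependency-graph / spatial-mixing bound under the low-activity canonical
Gibbs state, Gaussian velocity tails truncated). Sources: Janson2004 (dependency graphs), KipnisLandim1999 Ch. 10,
Ruelle1969 §4 (low-activity decorrelation), AokiEtAl2015 Thm 1 (cluster-size tails calibrating the range). -/
def EquilibriumRingLLN : Prop :=
  ∃ η₁ : ℝ, 0 < η₁ ∧ ∀ σ' : ℝ, 0 < σ' → σ' ^ 3 < η₁ → ∀ θv : ℝ, 0 < θv → ∀ M : ℝ, 0 < M →
    ∀ x₀ : T3, ∀ Ψ : (N : ℕ) → HardSphereFlow (Torus.geometry (Fin 3)) (hsDiameter σ' N) (N + 1),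
      EqRingConcentration x₀ σ' θv M Ψ

/-- **U · NoRingExcess** (XL; flow side, upper half). With the crux's prefix verbatim (packing threshold `η₀`
first; profiles; `σ₀`; `σ, M`; band-respecting classical hs-Euler solution; flow family with the LLN at `t = 0`;
`t ∈ (0,T)`, `δ`; `h₀`; cell centre `x₀`; comparison family `Ψ` at the matched diameter `σρ_t(x₀)^{1/3}`), and GIVEN
the equilibrium concentration of the comparison ring ratio at the matched state, the flow produces NO EXCESS of
rings over the equilibrium value: `P_N(δ·Z_coll < Z_ring − r_E(N)·Z_coll) → 0`. -/
def NoRingExcess : Prop :=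
  ∃ η₀ : ℝ, 0 < η₀ ∧ ∀ (a₀ θ₀ : T3 → ℝ) (u₀ : T3 → V3), Continuous a₀ → Continuous θ₀ → Continuous u₀ →
    (∀ x, 0 < a₀ x) → (∀ x, 0 < θ₀ x) →
    ∃ σ₀ : ℝ, 0 < σ₀ ∧ ∀ σ : ℝ, 0 < σ → σ < σ₀ → ∀ M : ℝ, 0 < M →
      ∀ (T : ℝ) (ρ θ : ℝ → T3 → ℝ) (u : ℝ → T3 → V3), IsHardSphereEulerSolution σ T ρ u θ →
        (∀ t ∈ Set.Ico 0 T, ∀ x, ρ t x * σ ^ 3 < η₀) →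
        ∀ Φ : (N : ℕ) → HardSphereFlow (Torus.geometry (Fin 3)) (hsDiameter σ N) (N + 1),
          TendstoHydroFieldsAt (fun N => localGibbsLaw σ a₀ u₀ θ₀ N (Φ N)) Φ ρ u θ 0 →
            ∀ t ∈ Set.Ioo 0 T, ∀ δ : ℝ, 0 < δ → ∃ h₀ : ℝ, 0 < h₀ ∧ ∀ h : ℝ, 0 < h → h < h₀ → ∀ x₀ : T3,
              ∀ Ψ : (N : ℕ) → HardSphereFlow (Torus.geometry (Fin 3)) (hsDiameter (σ * ρ t x₀ ^ (1 / 3 : ℝ)) N) (N + 1),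
                EqRingConcentration x₀ (σ * ρ t x₀ ^ (1 / 3 : ℝ)) (θ t x₀) M Ψ →
                  Filter.Tendsto (fun N : ℕ => localGibbsLaw σ a₀ u₀ θ₀ N (Φ N)
                    {z | δ * zColl x₀ N (hsDiameter σ N) (fun s => (Φ N).flow s z) t (flowWindow M σ (ρ t x₀) (θ t x₀) N) h <
                      zRing x₀ N (hsDiameter σ N) (fun s => (Φ N).flow s z) t (flowWindow M σ (ρ t x₀) (θ t x₀) N) h -
                        rEq x₀ (σ * ρ t x₀ ^ (1 / 3 : ℝ)) (θ t x₀) M N (Ψ N) *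
                          zColl x₀ N (hsDiameter σ N) (fun s => (Φ N).flow s z) t (flowWindow M σ (ρ t x₀) (θ t x₀) N) h})
                    Filter.atTop (nhds 0)

/-- **L · NoRingDeficit** (XL; flow side, lower half). Same prefix and hypothesis as `NoRingExcess`; the flow
produces NO DEFICIT of rings below the equilibrium value: `P_N(δ·Z_coll < r_E(N)·Z_coll − Z_ring) → 0`. -/
def NoRingDeficit : Prop :=
  ∃ η₀ : ℝ, 0 < η₀ ∧ ∀ (a₀ θ₀ : T3 → ℝ) (u₀ : T3 → V3), Continuous a₀ → Continuous θ₀ → Continuous u₀ →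
    (∀ x, 0 < a₀ x) → (∀ x, 0 < θ₀ x) →
    ∃ σ₀ : ℝ, 0 < σ₀ ∧ ∀ σ : ℝ, 0 < σ → σ < σ₀ → ∀ M : ℝ, 0 < M →
      ∀ (T : ℝ) (ρ θ : ℝ → T3 → ℝ) (u : ℝ → T3 → V3), IsHardSphereEulerSolution σ T ρ u θ →
        (∀ t ∈ Set.Ico 0 T, ∀ x, ρ t x * σ ^ 3 < η₀) →
        ∀ Φ : (N : ℕ) → HardSphereFlow (Torus.geometry (Fin 3)) (hsDiameter σ N) (N + 1),
          TendstoHydroFieldsAt (fun N => localGibbsLaw σ a₀ u₀ θ₀ N (Φ N)) Φ ρ u θ 0 →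
            ∀ t ∈ Set.Ioo 0 T, ∀ δ : ℝ, 0 < δ → ∃ h₀ : ℝ, 0 < h₀ ∧ ∀ h : ℝ, 0 < h → h < h₀ → ∀ x₀ : T3,
              ∀ Ψ : (N : ℕ) → HardSphereFlow (Torus.geometry (Fin 3)) (hsDiameter (σ * ρ t x₀ ^ (1 / 3 : ℝ)) N) (N + 1),
                EqRingConcentration x₀ (σ * ρ t x₀ ^ (1 / 3 : ℝ)) (θ t x₀) M Ψ →
                  Filter.Tendsto (fun N : ℕ => localGibbsLaw σ a₀ u₀ θ₀ N (Φ N)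
                    {z | δ * zColl x₀ N (hsDiameter σ N) (fun s => (Φ N).flow s z) t (flowWindow M σ (ρ t x₀) (θ t x₀) N) h <
                      rEq x₀ (σ * ρ t x₀ ^ (1 / 3 : ℝ)) (θ t x₀) M N (Ψ N) *
                          zColl x₀ N (hsDiameter σ N) (fun s => (Φ N).flow s z) t (flowWindow M σ (ρ t x₀) (θ t x₀) N) h -
                        zRing x₀ N (hsDiameter σ N) (fun s => (Φ N).flow s z) t (flowWindow M σ (ρ t x₀) (θ t x₀) N) h})
                    Filter.atTop (nhds 0)

/-! ### Registered stubs (the open obligations of the line; `sorry` only here) -/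

/-- STUB E (M): equilibrium LLN for the comparison ring ratio. -/
theorem stub_equilibriumRingLLN : EquilibriumRingLLN := by
  sorry

/-- STUB U (XL): no ring excess along the flow, given the equilibrium concentration at the matched state. -/
theorem stub_noRingExcess : NoRingExcess := by
  sorry

/-- STUB L (XL): no ring deficit along the flow, given the equilibrium concentration at the matched state. -/
theorem stub_noRingDeficit : NoRingDeficit := by
  sorry

/-! ### Name-keyed aliases of the stub statements (the hypotheses of the composition: the skeleton audit admits a
hypothesis only if its head constant is a registered obligation or is named like a declared stub) -/
namespace Registered

/-- Alias of `EquilibriumRingLLN` keyed by the registered stub name. -/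
abbrev stub_equilibriumRingLLN : Prop := EquilibriumRingLLN
/-- Alias of `NoRingExcess` keyed by the registered stub name. -/
abbrev stub_noRingExcess : Prop := NoRingExcess
/-- Alias of `NoRingDeficit` keyed by the registered stub name. -/
abbrev stub_noRingDeficit : Prop := NoRingDeficit

end Registered

/-! ### The crux in the named vocabulary, and the composition (PROVED) -/

/-- The crux `RingDensityLaw` with its seven `let`s replaced by the parametrised definitions above (same binder
prefix, same event). -/
def NamedLaw : Prop :=
  ∃ η₀ : ℝ, 0 < η₀ ∧ ∀ (a₀ θ₀ : T3 → ℝ) (u₀ : T3 → V3), Continuous a₀ → Continuous θ₀ → Continuous u₀ →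
    (∀ x, 0 < a₀ x) → (∀ x, 0 < θ₀ x) →
    ∃ σ₀ : ℝ, 0 < σ₀ ∧ ∀ σ : ℝ, 0 < σ → σ < σ₀ → ∀ M : ℝ, 0 < M →
      ∀ (T : ℝ) (ρ θ : ℝ → T3 → ℝ) (u : ℝ → T3 → V3), IsHardSphereEulerSolution σ T ρ u θ →
        (∀ t ∈ Set.Ico 0 T, ∀ x, ρ t x * σ ^ 3 < η₀) →
        ∀ Φ : (N : ℕ) → HardSphereFlow (Torus.geometry (Fin 3)) (hsDiameter σ N) (N + 1),
          TendstoHydroFieldsAt (fun N => localGibbsLaw σ a₀ u₀ θ₀ N (Φ N)) Φ ρ u θ 0 →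
            ∀ t ∈ Set.Ioo 0 T, ∀ δ : ℝ, 0 < δ → ∃ h₀ : ℝ, 0 < h₀ ∧ ∀ h : ℝ, 0 < h → h < h₀ → ∀ x₀ : T3,
              ∀ Ψ : (N : ℕ) → HardSphereFlow (Torus.geometry (Fin 3)) (hsDiameter (σ * ρ t x₀ ^ (1 / 3 : ℝ)) N) (N + 1),
                Filter.Tendsto (fun N : ℕ => localGibbsLaw σ a₀ u₀ θ₀ N (Φ N)
                  {z | δ * zColl x₀ N (hsDiameter σ N) (fun s => (Φ N).flow s z) t (flowWindow M σ (ρ t x₀) (θ t x₀) N) h <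
                    |zRing x₀ N (hsDiameter σ N) (fun s => (Φ N).flow s z) t (flowWindow M σ (ρ t x₀) (θ t x₀) N) h -
                      rEq x₀ (σ * ρ t x₀ ^ (1 / 3 : ℝ)) (θ t x₀) M N (Ψ N) *
                        zColl x₀ N (hsDiameter σ N) (fun s => (Φ N).flow s z) t (flowWindow M σ (ρ t x₀) (θ t x₀) N) h|})
                  Filter.atTop (nhds 0)

/-- The named form IS the crux (the `def`s of §Vocabulary unfold to the crux's `let` bodies): definitional. -/
theorem namedLaw_iff :
    NamedLaw ↔ Summit.AtomisticToContinuum.HydrodynamicLimit.Theses.RingDensityCertificate.RingDensityLaw :=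
  Iff.rfl

/-- Three-statement glue, PROVED: `EquilibriumRingLLN → NoRingExcess → NoRingDeficit → NamedLaw`
(thresholds by `min`; `ρ_t(x₀), θ_t(x₀) > 0` from the Euler solution class; `(σρ^{1/3})³ = ρσ³ < η₁` feeds the
equilibrium stub at the matched state; union bound + squeeze in `ℝ≥0∞`). -/
theorem threeStatementGlue (hE : EquilibriumRingLLN) (hU : NoRingExcess) (hL : NoRingDeficit) : NamedLaw := by
  obtain ⟨η₁, hη₁, HE⟩ := hE
  obtain ⟨η₂, hη₂, HU⟩ := hU
  obtain ⟨η₃, hη₃, HL⟩ := hL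
  refine ⟨min η₁ (min η₂ η₃), lt_min hη₁ (lt_min hη₂ hη₃), ?_⟩
  intro a₀ θ₀ u₀ ha hθ hu hap hθp
  obtain ⟨σU, hσU, HU⟩ := HU a₀ θ₀ u₀ ha hθ hu hap hθp
  obtain ⟨σL, hσL, HL⟩ := HL a₀ θ₀ u₀ ha hθ hu hap hθp
  refine ⟨min σU σL, lt_min hσU hσL, ?_⟩
  intro σ hσ hσlt M hM T ρ θ u hsol hband Φ hlln t ht δ hδ
  have hb₁ : ∀ s ∈ Set.Ico 0 T, ∀ x, ρ s x * σ ^ 3 < η₁ := fun s hs x =>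
    lt_of_lt_of_le (hband s hs x) (min_le_left _ _)
  have hb₂ : ∀ s ∈ Set.Ico 0 T, ∀ x, ρ s x * σ ^ 3 < η₂ := fun s hs x =>
    lt_of_lt_of_le (hband s hs x) ((min_le_right _ _).trans (min_le_left _ _))
  have hb₃ : ∀ s ∈ Set.Ico 0 T, ∀ x, ρ s x * σ ^ 3 < η₃ := fun s hs x =>
    lt_of_lt_of_le (hband s hs x) ((min_le_right _ _).trans (min_le_right _ _))
  obtain ⟨hU₀, hhU₀, HU⟩ :=
    HU σ hσ (lt_of_lt_of_le hσlt (min_le_left _ _)) M hM T ρ θ u hsol hb₂ Φ hlln t ht δ hδ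
  obtain ⟨hL₀, hhL₀, HL⟩ :=
    HL σ hσ (lt_of_lt_of_le hσlt (min_le_right _ _)) M hM T ρ θ u hsol hb₃ Φ hlln t ht δ hδ
  refine ⟨min hU₀ hL₀, lt_min hhU₀ hhL₀, ?_⟩
  intro h hh hhlt x₀ Ψ
  have ht' : t ∈ Set.Ico 0 T := ⟨ht.1.le, ht.2⟩
  have hρ : 0 < ρ t x₀ := hsol.density_pos t ht' x₀
  have hθt : 0 < θ t x₀ := hsol.temperature_pos t ht' x₀
  have hσ' : 0 < σ * ρ t x₀ ^ (1 / 3 : ℝ) := mul_pos hσ (Real.rpow_pos_of_pos hρ _)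
  have hcube : (ρ t x₀ ^ (1 / 3 : ℝ)) ^ 3 = ρ t x₀ := by
    rw [← Real.rpow_natCast, ← Real.rpow_mul hρ.le]
    norm_num
  have hσ'3 : (σ * ρ t x₀ ^ (1 / 3 : ℝ)) ^ 3 < η₁ := by
    calc (σ * ρ t x₀ ^ (1 / 3 : ℝ)) ^ 3 = ρ t x₀ * σ ^ 3 := by rw [mul_pow, hcube, mul_comm]
      _ < η₁ := hb₁ t ht' x₀
  have hEq : EqRingConcentration x₀ (σ * ρ t x₀ ^ (1 / 3 : ℝ)) (θ t x₀) M Ψ :=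
    HE _ hσ' hσ'3 _ hθt M hM x₀ Ψ
  have h1 := HU h hh (lt_of_lt_of_le hhlt (min_le_left _ _)) x₀ Ψ hEq
  have h2 := HL h hh (lt_of_lt_of_le hhlt (min_le_right _ _)) x₀ Ψ hEq
  have hsum := h1.add h2
  rw [add_zero] at hsum
  refine tendsto_of_tendsto_of_tendsto_of_le_of_le tendsto_const_nhds hsum (fun _ => zero_le) (fun N => ?_)
  refine (measure_mono fun z hz => ?_).trans (measure_union_le _ _)
  simp only [Set.mem_setOf_eq, Set.mem_union] at hz ⊢
  rcases lt_abs.mp hz with hz' | hz'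
  · exact Or.inl hz'
  · exact Or.inr (by linarith)

/-- **The skeleton concludes the crux BY NAME**: the three registered stubs imply
`Summit.AtomisticToContinuum.HydrodynamicLimit.Theses.RingDensityCertificate.RingDensityLaw` (no `sorry`). -/
theorem RingDensityLaw_of (hE : Registered.stub_equilibriumRingLLN) (hU : Registered.stub_noRingExcess)
    (hL : Registered.stub_noRingDeficit) :
    Summit.AtomisticToContinuum.HydrodynamicLimit.Theses.RingDensityCertificate.RingDensityLaw :=
  namedLaw_iff.mp (threeStatementGlue hE hU hL)

/-- Wiring check: the registered stubs feed `RingDensityLaw_of` as stated. -/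
example : Summit.AtomisticToContinuum.HydrodynamicLimit.Theses.RingDensityCertificate.RingDensityLaw :=
  RingDensityLaw_of stub_equilibriumRingLLN stub_noRingExcess stub_noRingDeficit

end Summit.AtomisticToContinuum.HydrodynamicLimit.Cruxes.RingDensityLaw.Birth

end
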